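import Summits.HubbardSuperconductivity.HubbardLadder.Bounds.ThermalMottCDWCeiling
import Literature.MathematicalPhysics.QuantumLattice.HubbardThermalPseudospinIsotropy
import Literature.MathematicalPhysics.QuantumLattice.ShastryPairingInequalitiesProjectionProofs
import HarnessLib

/-!
# Hubbard ladder — Bounds: the thermal Mott-window ceiling on the uniform `s`-wave (on-site) PAIR
# structure factor of the half-filled repulsive torus at `T > 0`
# (bounds.tex Cor. 11.1(ii), pair half — typed AND proved modulo the cited Kubo–Kishi Gaussian domination)

HONEST FRAMING (cell pub-hubbard): ladder R1–R4 with certified numbers; no claim on H/H₀. These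
are bounds for a MODEL CLASS — the repulsive Hubbard torus `hamiltonianWith (fermionTorusGraph 2 L)
1 U (U/2)` (`= hubbardTorusWith 2 L 1 U (U/2)` by `rfl`; `t = 1`, `U > 0`, chemical potential
`μ = U/2`, torus `(ℤ/Lℤ)²`, `L ≥ 4` even) in its GRAND-CANONICAL Gibbs state `⟨·⟩_β` on the full
Fock space at `β > 0`; no materials claim. Companion text: `pub-hubbard/paper/bounds.tex` Cor. 11.1(ii);
tables `pub-hubbard/pub-hubbard-bounds/BOUNDS.md` (row T9♯) and `EXTREMISERS.md` §5q.

This file completes the machine-checking of Cor. 11.1: part (i) (the grand-canonical Mott-window kinetic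
ceiling) and the CDW half of part (ii) are `ThermalMottCDWCeiling.lean`
(`re_gibbsState_hoppingForm_le_mott_gc`, `re_gibbsState_staggeredCharge_sq_le_mott_gc`; LEAN FILING
REQUEST #163 — its generic glue `ThermalMottCDWCeilingGlue.lean` is in the tree, p243049); the remaining
paper-level step — Zhang's pseudospin `SU(2)` rotation taking the staggered charge field
`F_Q = Σ_x (-1)^x (n_x - 1)` to the uniform on-site pair field `B = Σ_x c_{x↓} c_{x↑}` — is now the
Literature theorem `hubbard_re_gibbsState_pair_eq_half_staggeredCharge_sq`
(`Literature/MathematicalPhysics/QuantumLattice/HubbardThermalPseudospinIsotropy.lean`, in the tree,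
p243241 commit 4e54fa7257bd: for every `K`
commuting with `η†_ε`, `⟨(n_x - 1)(n_y - 1)⟩_{β,K} = 2 ε_x ε_y ⟨Δ†_x Δ_y⟩_{β,K}` for `x ≠ y` and
`⟨F_ε²⟩ = 2⟨η†_1 η_1⟩ - ⟨N - |Λ|⟩`; at `μ = U/2` on a bipartite-signed graph `⟨N⟩_β = |Λ|` by
Lieb–Loss–McCann, so `⟨F_ε²⟩_β = 2⟨B†B⟩_β` EXACTLY, at every temperature).

## What is proved (no `sorry`, no new axioms)

On the torus (`L ≥ 4` even — `Even L`, `3 ≤ L` —; `B†B = η†_1 η_1 = Σ_{x,y} Δ†_x Δ_y`,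
`Δ†_x = c†_{x↑} c†_{x↓}`; `B = uniformOnSitePair 2 L` is Shastry's field, `B† B = η†_1 η_1` by
`conjTranspose_uniformOnSitePair_mul_self`):
* `re_gibbsState_uniformPair_eq_half_staggeredCharge_sq` — the exact identity
  `Re⟨η†_1 η_1⟩_β = ½ Re⟨F_Q²⟩_β` for `hamiltonianWith (fermionTorusGraph 2 L) 1 U (U/2)`, every real
  `U`, every `β` (unconditional; the Literature theorem instantiated by name).
* `re_gibbsState_uniformPair_le_mott_gc` — **Cor. 11.1(ii), pair half** (conditional on the cited
  Kubo–Kishi Gaussian domination `kuboKishi_charge_gaussianDomination`, KK90 Thm 2): for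
  `0 ≤ U₁ < U`, `Δ ≠ 0`, `β > 0`,
  `Re⟨B†B⟩_β ≤ ½ [L²/(βU) + ½ √((L²/U) · 4 k_max)]`, `k_max` the right side of Cor. 11.1(i)
  (`re_gibbsState_hoppingForm_le_mott_gc`); per site
  `P_s := ⟨B†B⟩_β/L² ≤ T/(2U) + ½ √(κ̃/U)`, `κ̃ = (U₁ sdwClosed U Δ - U lmClosed U₁)/(U - U₁) +
  (U₁/(U - U₁)) T log 4`; Shastry-`B` form `re_gibbsState_conjTranspose_uniformOnSitePair_mul_le_mott_gc`.
* Nodes `ThermalMottSWavePairCeilingKK` (`@[conjecture] def`, proved by `…_holds`) and the instance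
  `ThermalMottSWavePairCeilingU20KK` (`U = 20`, `U₁ = Δ = 10`): `P_s ≤ T/40 + ½ √((1.228 + T log 4)/20)`
  (`= 0.124` at `T → 0`; Kubo–Kishi's degree form, KK90 Remark 3, gives `½√(4/20) = 0.224` there; the
  free-fermion value at `T = 0` is `½`, the atomic-limit value `⟨D⟩ → 0`).

Honest numbers: an `O(1)` per-site ceiling, i.e. an `O(1/L²)` ceiling on the `s`-wave pair ODLRO density
`⟨B†B⟩/L⁴` — no on-site pairing long-range order at any `T > 0` in the Mott window with an explicit,
interaction-dependent constant; informative only for `U ≳ 14 t`, `T ≲ t`; no decay information; restricted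
to `μ = U/2` (half filling on average) and bipartite hopping (`t' = 0`), where the `η`-symmetry is exact;
nothing here bears on d-wave pairing or on the doped model. CONDITIONAL on the published
Gaussian-domination inequality of Kubo–Kishi (a named Literature fact used as a hypothesis, never an
axiom); the identity `⟨F_Q²⟩_β = 2⟨B†B⟩_β` is unconditional.
References (keys of `lean/references.bib`): Zhang1990; YangZhang1990 Thm 1; KuboKishi1990 Thm 2,
Remark 3; LiebLossMccann1993 Thm eq. (5); Shastry1997 eq. (1); LangerMattis1971 eqs. (3)–(5);
DysonLiebSimon1978 Thm 3.1; HazraVermaRanderia2019 §III.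
-/


noncomputable section

namespace Summit.HubbardSuperconductivity.HubbardLadder.Bounds

open Matrix Finset Real
open Literature.MathematicalPhysics.QuantumLattice
open Literature.Probability.LatticeModels
open scoped ComplexOrder ComplexConjugate

section Torus

variable {L : ℕ} [NeZero L]

/-- `H(1,U') - (U'/2)N` on the torus (`= hubbardTorusWith 2 L 1 U' (U'/2)`). -/
local notation "H[" U' "]" => hamiltonianWith (fermionTorusGraph 2 L) 1 U' (U' / 2)
/-- The staggered charge field `F_Q = Σ_x (-1)^x (n_x - 1)`. -/
local notation "F_Q" =>
  chargeDensityField fun x => ((torusStagger (d := 2) (L := L) x : ℤ) : ℝ)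
/-- The uniform on-site pair structure factor operator `B† B = η†_1 η_1 = Σ_{x,y} Δ†_x Δ_y`. -/
local notation "P_S" =>
  etaRaise (fun _ : FermionTorus 2 L => (1 : ℤˣ)) * etaLower (fun _ : FermionTorus 2 L => (1 : ℤˣ))

/-- `B† B = η†_1 η_1` for Shastry's uniform on-site pair field `B = Σ_x c_{x↓} c_{x↑} = uniformOnSitePair 2 L`
(`B = (η†_1)ᴴ`, `uniformOnSitePair_eq_conjTranspose_etaRaise`; `η_1 = (η†_1)ᴴ` by definition). -/
theorem conjTranspose_uniformOnSitePair_mul_self :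
    (uniformOnSitePair 2 L)ᴴ * uniformOnSitePair 2 L = P_S := by
  rw [uniformOnSitePair_eq_conjTranspose_etaRaise, conjTranspose_conjTranspose]
  rfl

omit [NeZero L] in
/-- **Pseudospin isotropy on the torus, every temperature (Zhang 1990):** `Re⟨B†B⟩_β = ½ Re⟨F_Q²⟩_β` in the
Gibbs state of `H(1,U) - (U/2)N`, `L` even, every real `U`, every `β` (the Literature theorem
`hubbardTorus_gibbsState_staggeredCharge_sq_eq_two_mul_pair` at `d = 2`, `t = 1`; `ε = torusStagger`). -/
theorem re_gibbsState_uniformPair_eq_half_staggeredCharge_sq (hLe : Even L) (U β : ℝ) :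
    (gibbsState β (H[U]) P_S).re = 1 / 2 * (gibbsState β (H[U]) (F_Q * F_Q)).re := by
  -- the torus form of the Literature identity carries the torus's own instances; `hubbardTorusWith = H[U]` is `rfl`
  have h := hubbardTorus_gibbsState_staggeredCharge_sq_eq_two_mul_pair (d := 2) (L := L) hLe 1 U β
  rw [show hubbardTorusWith 2 L 1 U (U / 2) = H[U] from rfl] at h
  have h2 : ∀ z : ℂ, ((2 : ℂ) * z).re = 2 * z.re := fun z => by simp [Complex.mul_re]
  rw [h, h2]
  ring

/-- **Cor. 11.1(ii), pair half: the uniform `s`-wave pair structure factor of the half-filled repulsive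
torus in the Mott window** (`L ≥ 4` even, `0 ≤ U₁ < U`, `Δ ≠ 0`, `β > 0`; conditional on Kubo–Kishi's
Gaussian domination, KK90 Thm 2): with `B†B = Σ_{x,y} Δ†_x Δ_y` and `k_max` the right side of
Cor. 11.1(i), `Re⟨B†B⟩_β ≤ ½ [L²/(βU) + ½ √((L²/U) · 4 k_max)]`, i.e. per site
`P_s ≤ T/(2U) + ½ √(κ̃/U)`. [Zhang1990 pseudospin rotation (`re_gibbsState_uniformPair_eq_half_staggeredCharge_sq`)
+ the CDW ceiling `re_gibbsState_staggeredCharge_sq_le_mott_gc`.] -/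
theorem re_gibbsState_uniformPair_le_mott_gc (hKK : kuboKishi_charge_gaussianDomination)
    (hLe : Even L) (hL : 3 ≤ L) {U U₁ Δ β : ℝ} (hU₁ : 0 ≤ U₁) (hU : U₁ < U) (hΔ : Δ ≠ 0)
    (hβ : 0 < β) :
    (gibbsState β (H[U]) P_S).re ≤
      1 / 2 * ((L : ℝ) ^ 2 / U / β +
        1 / 2 * Real.sqrt ((L : ℝ) ^ 2 / U *
          (4 * ((L : ℝ) ^ 2 * ((U₁ * sdwClosed U Δ - U * lmClosed U₁) / (U - U₁)) +
            U₁ / (U - U₁) * ((L : ℝ) ^ 2 * Real.log 4 / β))))) := by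
  rw [re_gibbsState_uniformPair_eq_half_staggeredCharge_sq hLe U β]
  exact mul_le_mul_of_nonneg_left
    (re_gibbsState_staggeredCharge_sq_le_mott_gc hKK hLe hL hU₁ hU hΔ hβ) (by norm_num)

/-- The same with Shastry's field: `Re⟨B† B⟩_β ≤ ½ [L²/(βU) + ½ √((L²/U) · 4 k_max)]` for
`B = uniformOnSitePair 2 L = Σ_x c_{x↓} c_{x↑}`. [Shastry1997 eq. (1) for `B`; Zhang1990; KuboKishi1990 Thm 2.] -/
theorem re_gibbsState_conjTranspose_uniformOnSitePair_mul_le_mott_gc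
    (hKK : kuboKishi_charge_gaussianDomination) (hLe : Even L) (hL : 3 ≤ L) {U U₁ Δ β : ℝ}
    (hU₁ : 0 ≤ U₁) (hU : U₁ < U) (hΔ : Δ ≠ 0) (hβ : 0 < β) :
    (gibbsState β (H[U]) ((uniformOnSitePair 2 L)ᴴ * uniformOnSitePair 2 L)).re ≤
      1 / 2 * ((L : ℝ) ^ 2 / U / β +
        1 / 2 * Real.sqrt ((L : ℝ) ^ 2 / U *
          (4 * ((L : ℝ) ^ 2 * ((U₁ * sdwClosed U Δ - U * lmClosed U₁) / (U - U₁)) +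
            U₁ / (U - U₁) * ((L : ℝ) ^ 2 * Real.log 4 / β))))) := by
  rw [conjTranspose_uniformOnSitePair_mul_self]
  exact re_gibbsState_uniformPair_le_mott_gc hKK hLe hL hU₁ hU hΔ hβ

/-- Node form of Cor. 11.1(ii), pair half (conditional on the cited Kubo–Kishi Gaussian domination).
Per site: `P_s := ⟨B†B⟩_β/L² ≤ T/(2U) + ½ √(κ̃/U)`, `B = uniformOnSitePair 2 L = Σ_x c_{x↓} c_{x↑}`
(Shastry's uniform on-site pair field; `B†B = η†_1 η_1 = Σ_{x,y} c†_{x↑} c†_{x↓} c_{y↓} c_{y↑}`).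
kind: support (PROVED, modulo the named Literature fact `kuboKishi_charge_gaussianDomination`).
Why it might fail: the Lean statement cannot; the cited Gaussian domination is KK90 Thm 2
(reflection-free, every bipartite graph). Sources: Zhang1990; YangZhang1990 Thm 1; KuboKishi1990
Thm 2, Remark 3; LiebLossMccann1993 Thm eq. (5); this cell (bounds.tex Cor. 11.1(ii)). -/
@[conjecture] def ThermalMottSWavePairCeilingKK : Prop :=
  kuboKishi_charge_gaussianDomination →
  ∀ (L : ℕ) [NeZero L], Even L → 3 ≤ L → ∀ (U U₁ Δ β : ℝ), 0 ≤ U₁ → U₁ < U → Δ ≠ 0 → 0 < β →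
    (gibbsState β (hamiltonianWith (fermionTorusGraph 2 L) 1 U (U / 2))
        ((uniformOnSitePair 2 L)ᴴ * uniformOnSitePair 2 L)).re ≤
      1 / 2 * ((L : ℝ) ^ 2 / U / β +
        1 / 2 * Real.sqrt ((L : ℝ) ^ 2 / U *
          (4 * ((L : ℝ) ^ 2 * ((U₁ * sdwClosed U Δ - U * lmClosed U₁) / (U - U₁)) +
            U₁ / (U - U₁) * ((L : ℝ) ^ 2 * Real.log 4 / β)))))

omit [NeZero L] in
/-- **`ThermalMottSWavePairCeilingKK` holds.** -/
theorem thermalMottSWavePairCeilingKK_holds : ThermalMottSWavePairCeilingKK := by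
  intro hKK L _ hLe hL U U₁ Δ β hU₁ hU hΔ hβ
  exact re_gibbsState_conjTranspose_uniformOnSitePair_mul_le_mott_gc hKK hLe hL hU₁ hU hΔ hβ

/-! ### The instance `U = 20 t` (`U₁ = Δ = 10`) -/

/-- **`U = 20 t`: `P_s ≤ T/40 + ½ √((1.228 + T log 4)/20)`** per site for the grand-canonical
half-filled torus, every even `L ≥ 4`, every `T = 1/β > 0` (conditional on KK90 Thm 2; `= 0.124` at
`T → 0`; half of `ThermalMottCDWCeilingU20KK`). kind: support (PROVED modulo the named fact). -/
@[conjecture] def ThermalMottSWavePairCeilingU20KK : Prop :=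
  kuboKishi_charge_gaussianDomination →
  ∀ (L : ℕ) [NeZero L], Even L → 3 ≤ L → ∀ β : ℝ, 0 < β →
    (gibbsState β (hamiltonianWith (fermionTorusGraph 2 L) 1 20 (20 / 2))
        ((uniformOnSitePair 2 L)ᴴ * uniformOnSitePair 2 L)).re ≤
      (L : ℝ) ^ 2 * (1 / (40 * β) + 1 / 2 * Real.sqrt ((1.228 + Real.log 4 / β) / 20))

omit [NeZero L] in
/-- **`ThermalMottSWavePairCeilingU20KK` holds.** -/
theorem thermalMottSWavePairCeilingU20KK_holds : ThermalMottSWavePairCeilingU20KK := by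
  intro hKK L _ hLe hL β hβ
  have h := thermalMottCDWCeilingU20KK_holds hKK L hLe hL β hβ
  rw [conjTranspose_uniformOnSitePair_mul_self, re_gibbsState_uniformPair_eq_half_staggeredCharge_sq hLe 20 β]
  have e : 1 / 2 * ((L : ℝ) ^ 2 * (1 / (20 * β) + Real.sqrt ((1.228 + Real.log 4 / β) / 20))) =
      (L : ℝ) ^ 2 * (1 / (40 * β) + 1 / 2 * Real.sqrt ((1.228 + Real.log 4 / β) / 20)) := by
    ring
  rw [← e]
  exact mul_le_mul_of_nonneg_left h (by norm_num)

end Torus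

end Summit.HubbardSuperconductivity.HubbardLadder.Bounds
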